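import Literature.Analysis.FluidPDE.PassiveVectorLionsWeak
import Literature.Analysis.FluidPDE.DuchonRobertLionsEnergyEquality
import HarnessLib

/-!
# Lions' `L²` weak solution of the passive-vector equation: divergence-free slices

Analysis/FluidPDE proof-support file (everything proved; no definitions). Sequel of `PassiveVectorLionsWeak`:
the damped weak solution `v ∈ L²(μ_T)` produced by Lions' projection theorem lies in the closed span of the
divergence-free space–time tests; every continuous linear functional on `L²(μ_T)` vanishing on those tests
vanishes on `v`. With the functionals `f ↦ ∫_{μ_T} ⟪f, η(t) ∇θ_{k,z}(x)⟫` (`η ∈ C_c^∞(0,T)`,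
`θ_{k,z} = Re(z e_{-k})`, the scalar tests of Robinson–Rodrigo–Sadowski 2016, Ex. 2.14) this gives, for
a.e. `t`, the transversality `k · 𝓕(v(t))(k) = 0` of all Fourier coefficients, hence (Lemma 2.3 ibid.,
`isWeaklyDivFree_of_sum_mul_mFourierCoeff_eq_zero`) **`v(t)` is weakly divergence free for a.e. `t ∈ (0,T)`**.

* `sum_mul_mFourierCoeff_eq_zero_of_forall_pairing` — transversality at frequency `k` from the pairings with
  `∇ Re(z e_{-k})`, `z ∈ ℂ` (the computation inside `IsWeaklyDivFree.sum_mul_mFourierCoeff_eq_zero`);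
* `setIntegral_inner_smul_gradient_test_eq_zero` — the constraint functionals vanish on divergence-free tests;
* `ae_isWeaklyDivFree_of_mem_closure` — the extraction.

## References

* J. C. Robinson, J. L. Rodrigo, W. Sadowski, *The three-dimensional Navier–Stokes equations* (CUP 2016),
  Ex. 2.14, Lemma 2.3. [`RobinsonRodrigoSadowski2016`]
* J.-L. Lions, E. Magenes, *Non-homogeneous boundary value problems* I (1972), Chap. 3 §4.3. [`LionsMagenes1972`]
-/

noncomputable section

open MeasureTheory Set Filter Function TopologicalSpace
open scoped ENNReal NNReal InnerProductSpace Topology ContDiff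

namespace Literature.Analysis.FluidPDE

namespace Torus

variable {d : Type*} [Fintype d] [DecidableEq d]

/-! ## Transversality from the one-mode pairings -/

/-- **Transversality at frequency `k` from the pairings with `∇ Re(z e_{-k})`**: if `u ∈ L²(T^d; ℝ^d)` satisfies
`∫⟪u, ∇θ_z⟫ = 0` for the scalar tests `θ_z = Re (z e_{-k})`, all `z ∈ ℂ`, then `∑ⱼ kⱼ 𝓕(complexify ∘ u)(k)ⱼ = 0`
(the computation of Robinson–Rodrigo–Sadowski 2016, Ex. 2.14: the pairing is `Re(-2πi z k·û(k))`).
[cite: RobinsonRodrigoSadowski2016, Ex. 2.14 (solution p. 310)] -/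
theorem sum_mul_mFourierCoeff_eq_zero_of_forall_pairing {u : UnitAddTorus d → EuclideanSpace ℝ d}
    (hu : MemLp u 2 volume) (k : d → ℤ)
    (h : ∀ z : ℂ, z = 1 ∨ z = Complex.I → ∫ x, ⟪u x, FunctionSpaces.Torus.gradient
      (fun y : UnitAddTorus d => (FunctionSpaces.Torus.trigPoly {-k} (fun _ => z) y).re) x⟫_ℝ = 0) :
    ∑ j, (k j : ℂ) * UnitAddTorus.mFourierCoeff (FunctionSpaces.EuclideanSpace.complexify ∘ u) k j = 0 := by
  have hui : Integrable u volume := hu.integrable one_le_two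
  set Z : ℂ := ∑ j, (k j : ℂ) * UnitAddTorus.mFourierCoeff (FunctionSpaces.EuclideanSpace.complexify ∘ u) k j with hZ
  have key : ∀ z : ℂ, z = 1 ∨ z = Complex.I → (-(2 * Real.pi * Complex.I) * z * Z).re = 0 := by
    intro z hz
    have hθ : FunctionSpaces.Torus.IsSmooth (fun x : UnitAddTorus d => (FunctionSpaces.Torus.trigPoly {-k} (fun _ => z) x).re) :=
      FunctionSpaces.Torus.isSmooth_re_trigPoly _ _
    have h0 := h z hz
    have hpt : ∀ x, ⟪u x, FunctionSpaces.Torus.gradient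
        (fun y : UnitAddTorus d => (FunctionSpaces.Torus.trigPoly {-k} (fun _ => z) y).re) x⟫_ℝ =
        (∑ j, UnitAddTorus.mFourier (-k) x * (u x j : ℂ) * (-(2 * Real.pi * Complex.I) * (k j) * z)).re := by
      intro x
      rw [FunctionSpaces.Torus.inner_gradient_eq_sum_mul_partialDeriv (hθ.isContDiff (by simp)), Complex.re_sum]
      refine Finset.sum_congr rfl fun j _ => ?_
      rw [FunctionSpaces.Torus.partialDeriv_re_trigPoly, FunctionSpaces.Torus.trigPoly_apply, Finset.sum_singleton]
      simp only [Pi.neg_apply, Int.cast_neg, smul_eq_mul, ← Complex.re_ofReal_mul]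
      congr 1
      ring
    simp_rw [hpt] at h0
    have hint : ∀ j : d, Integrable
        (fun x => UnitAddTorus.mFourier (-k) x * (u x j : ℂ) * (-(2 * Real.pi * Complex.I) * (k j) * z)) volume := by
      intro j
      refine Integrable.mul_const ?_ _
      have huj : Integrable (fun x => (u x j : ℂ)) volume :=
        Complex.ofRealCLM.integrable_comp (hui.eval_piLp j)
      exact huj.bdd_mul (c := 1) (UnitAddTorus.mFourier (-k)).continuous.aestronglyMeasurable
        (Eventually.of_forall fun x => ((UnitAddTorus.mFourier (-k)).norm_coe_le_norm x).trans_eq UnitAddTorus.mFourier_norm)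
    have hsum : Integrable (fun x => ∑ j, UnitAddTorus.mFourier (-k) x * (u x j : ℂ) *
        (-(2 * Real.pi * Complex.I) * (k j) * z)) volume := integrable_finsetSum _ fun j _ => hint j
    have hre := integral_re hsum
    simp only [RCLike.re_to_complex] at hre
    rw [hre] at h0
    rw [integral_finsetSum _ fun j _ => hint j] at h0
    simp_rw [integral_mul_const, FunctionSpaces.Torus.integral_mFourier_neg_mul_coord hui] at h0
    rw [← h0]
    congr 1
    rw [hZ, Finset.mul_sum]
    refine Finset.sum_congr rfl fun j _ => ?_
    ring
  have h1 := key 1 (Or.inl rfl)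
  have h2 := key Complex.I (Or.inr rfl)
  simp only [mul_one, neg_mul, Complex.neg_re, Complex.mul_re, Complex.mul_im,
    Complex.re_ofNat, Complex.im_ofNat, Complex.ofReal_re, Complex.ofReal_im, Complex.I_re,
    Complex.I_im, mul_zero, zero_mul, sub_zero, add_zero, mul_one, zero_sub, neg_neg] at h1 h2
  apply Complex.ext
  · simp only [Complex.zero_re]
    nlinarith [Real.pi_pos]
  · simp only [Complex.zero_im]
    nlinarith [Real.pi_pos]

/-! ## The constraint functionals vanish on divergence-free tests -/

omit [DecidableEq d] in
/-- Points of `(0,T) × T^d` have their time coordinate in `(0,T)`, a.e. [folklore] -/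
private theorem ae_fst_mem_Ioo_prod₂ (T : ℝ) :
    ∀ᵐ p : ℝ × UnitAddTorus d ∂(((volume : Measure ℝ).restrict (Ioo 0 T)).prod volume), p.1 ∈ Ioo 0 T :=
  (Measure.quasiMeasurePreserving_fst (μ := (volume : Measure ℝ).restrict (Ioo 0 T))
    (ν := (volume : Measure (UnitAddTorus d)))).ae (ae_restrict_mem measurableSet_Ioo)

omit [DecidableEq d] in
/-- The weight fields `G(t,x) = η(t) ∇θ(x)` (`η` continuous, `θ` smooth) are bounded on `(0,T) × T^d` and in
`L²(μ_T)`. [cite: LionsMagenes1972, Chap. 3 §4.3] -/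
theorem memLp_two_smul_gradient {T : ℝ} {η : ℝ → ℝ} (hη : Continuous η) {θ : UnitAddTorus d → ℝ}
    (hθ : FunctionSpaces.Torus.IsSmooth θ) :
    MemLp (fun p : ℝ × UnitAddTorus d => η p.1 • FunctionSpaces.Torus.gradient θ p.2) 2
      (((volume : Measure ℝ).restrict (Ioo 0 T)).prod volume) := by
  obtain ⟨C₁, hC₁⟩ := (isCompact_Icc (a := (0:ℝ)) (b := T)).exists_bound_of_continuousOn hη.continuousOn
  obtain ⟨C₂, hC₂⟩ := (isCompact_univ.image hθ.gradient.continuous).isBounded.exists_norm_le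
  have hC₂' : ∀ x, ‖FunctionSpaces.Torus.gradient θ x‖ ≤ C₂ := fun x => hC₂ _ ⟨x, mem_univ _, rfl⟩
  have hm : AEStronglyMeasurable (fun p : ℝ × UnitAddTorus d => η p.1 • FunctionSpaces.Torus.gradient θ p.2)
      (((volume : Measure ℝ).restrict (Ioo 0 T)).prod volume) :=
    ((hη.comp continuous_fst).smul (hθ.gradient.continuous.comp continuous_snd)).aestronglyMeasurable
  have htop : MemLp (fun p : ℝ × UnitAddTorus d => η p.1 • FunctionSpaces.Torus.gradient θ p.2) ∞
      (((volume : Measure ℝ).restrict (Ioo 0 T)).prod volume) := by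
    refine memLp_top_of_bound hm (‖C₁‖ * C₂) ?_
    filter_upwards [ae_fst_mem_Ioo_prod₂ (d := d) T] with p hp
    rw [norm_smul]
    exact mul_le_mul ((hC₁ p.1 (Ioo_subset_Icc_self hp)).trans (le_abs_self _)) (hC₂' p.2) (norm_nonneg _)
      (norm_nonneg _)
  exact htop.mono_exponent le_top

/-- **The constraint functionals vanish on divergence-free tests**: for a divergence-free space–time test `ψ`,
`∫_{μ_T} ⟪ψ, η(t)∇θ(x)⟫ = ∫ η(t) (∫⟪ψ(t), ∇θ⟫) dt = 0` (smooth divergence-free slices are weakly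
divergence free). [cite: RobinsonRodrigoSadowski2016, Ex. 2.14 (solution p. 310)] -/
theorem integral_inner_test_smul_gradient_eq_zero {T : ℝ} {ψ : ℝ → UnitAddTorus d → EuclideanSpace ℝ d}
    (hψ : FunctionSpaces.Torus.IsSpaceTimeTest T ψ) (hdiv : FunctionSpaces.Torus.IsDivFreeTest ψ)
    {η : ℝ → ℝ} (hη : Continuous η) {θ : UnitAddTorus d → ℝ} (hθ : FunctionSpaces.Torus.IsSmooth θ) :
    ∫ p, ⟪uncurry ψ p, η p.1 • FunctionSpaces.Torus.gradient θ p.2⟫_ℝ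
      ∂(((volume : Measure ℝ).restrict (Ioo 0 T)).prod volume) = 0 := by
  have hG := memLp_two_smul_gradient (T := T) hη hθ
  have hint : Integrable (fun p : ℝ × UnitAddTorus d => ⟪uncurry ψ p, η p.1 • FunctionSpaces.Torus.gradient θ p.2⟫_ℝ)
      (((volume : Measure ℝ).restrict (Ioo 0 T)).prod volume) := by
    refine Integrable.mono' (((hψ.memLp_two_uncurry.integrable_norm_pow two_ne_zero).add
      (hG.integrable_norm_pow two_ne_zero)).div_const 2) (hψ.continuous_uncurry.aestronglyMeasurable.inner hG.1)
      (ae_of_all _ fun p => ?_)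
    show ‖⟪uncurry ψ p, η p.1 • FunctionSpaces.Torus.gradient θ p.2⟫_ℝ‖ ≤
      (‖uncurry ψ p‖ ^ 2 + ‖η p.1 • FunctionSpaces.Torus.gradient θ p.2‖ ^ 2) / 2
    rw [Real.norm_eq_abs]
    refine (abs_real_inner_le_norm _ _).trans ?_
    nlinarith [sq_nonneg (‖uncurry ψ p‖ - ‖η p.1 • FunctionSpaces.Torus.gradient θ p.2‖)]
  rw [integral_prod _ hint]
  have hslice : ∀ t, ∫ x, ⟪ψ t x, η t • FunctionSpaces.Torus.gradient θ x⟫_ℝ = 0 := by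
    intro t
    have h0 := FunctionSpaces.Torus.IsDivFree.isWeaklyDivFree_holds (hψ.isSmooth_slice t) (hdiv t) θ hθ
    simp only [real_inner_smul_right, integral_const_mul, h0, mul_zero]
  have e : (fun t => ∫ x, ⟪uncurry ψ (t, x), η (t, x).1 • FunctionSpaces.Torus.gradient θ (t, x).2⟫_ℝ) = fun _ => 0 := by
    funext t
    exact hslice t
  rw [e, integral_zero]

/-! ## Extraction: slices of elements of the closed span of the tests are weakly divergence free -/

/-- Continuous linear functionals `⟪toLp G, ·⟫` vanishing on the divergence-free tests vanish on the closed span.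
[cite: LionsMagenes1972, Chap. 3 §4.3] -/
theorem inner_eq_zero_of_mem_closure {T : ℝ}
    {G : ℝ × UnitAddTorus d → EuclideanSpace ℝ d}
    (hG : MemLp G 2 (((volume : Measure ℝ).restrict (Ioo 0 T)).prod (volume : Measure (UnitAddTorus d))))
    (hG0 : ∀ ψ : ℝ → UnitAddTorus d → EuclideanSpace ℝ d, FunctionSpaces.Torus.IsSpaceTimeTest T ψ →
      FunctionSpaces.Torus.IsDivFreeTest ψ →
      ∫ p, ⟪uncurry ψ p, G p⟫_ℝ ∂(((volume : Measure ℝ).restrict (Ioo 0 T)).prod volume) = 0)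
    {v : Lp (EuclideanSpace ℝ d) 2 (((volume : Measure ℝ).restrict (Ioo 0 T)).prod (volume : Measure (UnitAddTorus d)))}
    (hv : v ∈ (Submodule.span ℝ {f : Lp (EuclideanSpace ℝ d) 2
            (((volume : Measure ℝ).restrict (Ioo 0 T)).prod (volume : Measure (UnitAddTorus d))) |
          ∃ ψ : ℝ → UnitAddTorus d → EuclideanSpace ℝ d, FunctionSpaces.Torus.IsSpaceTimeTest T ψ ∧
            FunctionSpaces.Torus.IsDivFreeTest ψ ∧
            (f : ℝ × UnitAddTorus d → EuclideanSpace ℝ d) =ᵐ[((volume : Measure ℝ).restrict (Ioo 0 T)).prod volume]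
              uncurry ψ}).topologicalClosure) :
    ∫ p, ⟪(v : ℝ × UnitAddTorus d → EuclideanSpace ℝ d) p, G p⟫_ℝ
      ∂(((volume : Measure ℝ).restrict (Ioo 0 T)).prod volume) = 0 := by
  set μ : Measure (ℝ × UnitAddTorus d) := ((volume : Measure ℝ).restrict (Ioo 0 T)).prod volume with hμ
  set Λ : Lp (EuclideanSpace ℝ d) 2 μ →L[ℝ] ℝ := innerSL ℝ (hG.toLp G) with hΛ
  have hΛf : ∀ f : Lp (EuclideanSpace ℝ d) 2 μ,
      Λ f = ∫ p, ⟪(f : ℝ × UnitAddTorus d → EuclideanSpace ℝ d) p, G p⟫_ℝ ∂μ := by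
    intro f
    rw [hΛ, innerSL_apply_apply, MeasureTheory.L2.inner_def]
    refine integral_congr_ae ?_
    filter_upwards [hG.coeFn_toLp] with p hp
    rw [hp, real_inner_comm]
  -- the kernel of `Λ` is a closed submodule containing the generating set
  have hker : (Submodule.span ℝ {f : Lp (EuclideanSpace ℝ d) 2 μ |
      ∃ ψ : ℝ → UnitAddTorus d → EuclideanSpace ℝ d, FunctionSpaces.Torus.IsSpaceTimeTest T ψ ∧
        FunctionSpaces.Torus.IsDivFreeTest ψ ∧ (f : ℝ × UnitAddTorus d → EuclideanSpace ℝ d) =ᵐ[μ] uncurry ψ}).topologicalClosure ≤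
      LinearMap.ker (Λ : Lp (EuclideanSpace ℝ d) 2 μ →ₗ[ℝ] ℝ) := by
    refine Submodule.topologicalClosure_minimal _ (Submodule.span_le.2 ?_) (Λ.isClosed_ker)
    rintro f ⟨ψ, hψ, hdiv, hf⟩
    show Λ f = 0
    rw [hΛf, integral_congr_ae (show (fun p => ⟪(f : ℝ × UnitAddTorus d → EuclideanSpace ℝ d) p, G p⟫_ℝ) =ᵐ[μ]
      fun p => ⟪uncurry ψ p, G p⟫_ℝ from by filter_upwards [hf] with p hp; rw [hp])]
    exact hG0 ψ hψ hdiv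
  have h := hker hv
  rw [LinearMap.mem_ker] at h
  rw [← hΛf]
  exact h

omit [DecidableEq d] in
/-- Slices of an `L²(μ_T)` function are in `L²(T^d)` for a.e. `t ∈ (0,T)` (Tonelli). [folklore] -/
private theorem ae_memLp_two_slice_prod {T : ℝ} {v : ℝ × UnitAddTorus d → EuclideanSpace ℝ d}
    (hv : MemLp v 2 (((volume : Measure ℝ).restrict (Ioo 0 T)).prod (volume : Measure (UnitAddTorus d)))) :
    ∀ᵐ t ∂(volume.restrict (Ioo 0 T)), MemLp (fun x => v (t, x)) 2 volume := by
  have hm := hv.1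
  have hfin : ∫⁻ p, ‖v p‖ₑ ^ 2 ∂(((volume : Measure ℝ).restrict (Ioo 0 T)).prod (volume : Measure (UnitAddTorus d))) < ⊤ := by
    have h2 := lintegral_rpow_enorm_lt_top_of_eLpNorm_lt_top two_ne_zero ENNReal.ofNat_ne_top hv.eLpNorm_lt_top
    simp only [ENNReal.toReal_ofNat, ENNReal.rpow_two] at h2
    exact h2
  have hmeas : AEMeasurable (fun p : ℝ × UnitAddTorus d => ‖v p‖ₑ ^ 2)
      (((volume : Measure ℝ).restrict (Ioo 0 T)).prod (volume : Measure (UnitAddTorus d))) := hm.enorm.pow_const 2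
  rw [lintegral_prod _ hmeas] at hfin
  filter_upwards [ae_lt_top' hmeas.lintegral_prod_right' hfin.ne, hm.prodMk_left] with t ht hmt
  refine ⟨hmt, ?_⟩
  rw [eLpNorm_eq_lintegral_rpow_enorm_toReal two_ne_zero ENNReal.ofNat_ne_top, ENNReal.toReal_ofNat]
  have e : ∫⁻ x, ‖v (t, x)‖ₑ ^ (2 : ℝ) = ∫⁻ x, ‖v (t, x)‖ₑ ^ 2 := lintegral_congr fun x => by rw [ENNReal.rpow_two]
  rw [e]
  exact ENNReal.rpow_lt_top_of_nonneg (by norm_num) ht.ne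

/-- **Slices of elements of the closed span of the divergence-free tests are weakly divergence free.** If
`v ∈ L²(μ_T)` lies in the closure of the span of the divergence-free space–time tests on `[0,T)`, then for a.e.
`t ∈ (0,T)` the slice `v(t,·)` is in `L²(T^d)` and weakly divergence free (constraint functionals
`⟪·, η∇θ_{k,z}⟫_{L²(μ_T)}`, du Bois-Reymond in `t`, transversality of all Fourier coefficients and
Robinson–Rodrigo–Sadowski 2016, Lemma 2.3). [cite: RobinsonRodrigoSadowski2016, Lemma 2.3] -/
theorem ae_isWeaklyDivFree_of_mem_closure {T : ℝ}
    {v : Lp (EuclideanSpace ℝ d) 2 (((volume : Measure ℝ).restrict (Ioo 0 T)).prod (volume : Measure (UnitAddTorus d)))}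
    (hv : v ∈ (Submodule.span ℝ {f : Lp (EuclideanSpace ℝ d) 2
            (((volume : Measure ℝ).restrict (Ioo 0 T)).prod (volume : Measure (UnitAddTorus d))) |
          ∃ ψ : ℝ → UnitAddTorus d → EuclideanSpace ℝ d, FunctionSpaces.Torus.IsSpaceTimeTest T ψ ∧
            FunctionSpaces.Torus.IsDivFreeTest ψ ∧
            (f : ℝ × UnitAddTorus d → EuclideanSpace ℝ d) =ᵐ[((volume : Measure ℝ).restrict (Ioo 0 T)).prod volume]
              uncurry ψ}).topologicalClosure) :
    ∀ᵐ t ∂(volume.restrict (Ioo 0 T)),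
      MemLp (fun x => (v : ℝ × UnitAddTorus d → EuclideanSpace ℝ d) (t, x)) 2 volume ∧
        FunctionSpaces.Torus.IsWeaklyDivFree (fun x => (v : ℝ × UnitAddTorus d → EuclideanSpace ℝ d) (t, x)) := by
  have hvL2 : MemLp (v : ℝ × UnitAddTorus d → EuclideanSpace ℝ d) 2 (((volume : Measure ℝ).restrict (Ioo 0 T)).prod (volume : Measure (UnitAddTorus d))) := Lp.memLp v
  have hvm : AEStronglyMeasurable (v : ℝ × UnitAddTorus d → EuclideanSpace ℝ d) (((volume : Measure ℝ).restrict (Ioo 0 T)).prod (volume : Measure (UnitAddTorus d))) := hvL2.1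
  -- the scalar tests `θ_{k,z} = Re (z e_{-k})`, `z ∈ {1, i}`
  set zOf : Bool → ℂ := fun c => if c then 1 else Complex.I with hzOf
  set θ : (d → ℤ) × Bool → UnitAddTorus d → ℝ := fun i y =>
    (FunctionSpaces.Torus.trigPoly {-i.1} (fun _ => zOf i.2) y).re with hθ
  have hθs : ∀ i, FunctionSpaces.Torus.IsSmooth (θ i) := fun i => FunctionSpaces.Torus.isSmooth_re_trigPoly _ _
  -- the pairings `F_i(t) = ∫⟪v(t,·), ∇θ_i⟫`
  set F : (d → ℤ) × Bool → ℝ → ℝ := fun i t =>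
    ∫ x, ⟪(v : ℝ × UnitAddTorus d → EuclideanSpace ℝ d) (t, x), FunctionSpaces.Torus.gradient (θ i) x⟫_ℝ with hF
  -- `F_i` is integrable on `(0,T)`
  have hFint : ∀ i, IntegrableOn (F i) (Ioo 0 T) := by
    intro i
    obtain ⟨C, hC⟩ := (isCompact_univ.image (hθs i).gradient.continuous).isBounded.exists_norm_le
    have hC' : ∀ x, ‖FunctionSpaces.Torus.gradient (θ i) x‖ ≤ C := fun x => hC _ ⟨x, mem_univ _, rfl⟩
    have hint : Integrable (fun p : ℝ × UnitAddTorus d =>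
        ⟪(v : ℝ × UnitAddTorus d → EuclideanSpace ℝ d) p, FunctionSpaces.Torus.gradient (θ i) p.2⟫_ℝ) (((volume : Measure ℝ).restrict (Ioo 0 T)).prod (volume : Measure (UnitAddTorus d))) := by
      refine Integrable.mono' (((hvL2.integrable one_le_two).norm).mul_const C)
        (hvm.inner ((hθs i).gradient.continuous.comp continuous_snd).aestronglyMeasurable) (ae_of_all _ fun p => ?_)
      rw [Real.norm_eq_abs]
      exact (abs_real_inner_le_norm _ _).trans (mul_le_mul_of_nonneg_left (hC' p.2) (norm_nonneg _))
    exact hint.integral_prod_left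
  -- `∫ g F_i = 0` for smooth `g` compactly supported in `(0,T)`
  have hgF : ∀ i, ∀ g : ℝ → ℝ, ContDiff ℝ ∞ g → HasCompactSupport g → tsupport g ⊆ Ioo 0 T →
      ∫ t, g t • F i t = 0 := by
    intro i g hg hgc hgT
    have hG := memLp_two_smul_gradient (T := T) hg.continuous (hθs i)
    have h0 : ∫ p, ⟪(v : ℝ × UnitAddTorus d → EuclideanSpace ℝ d) p, g p.1 • FunctionSpaces.Torus.gradient (θ i) p.2⟫_ℝ ∂(((volume : Measure ℝ).restrict (Ioo 0 T)).prod (volume : Measure (UnitAddTorus d))) = 0 :=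
      inner_eq_zero_of_mem_closure hG (fun ψ hψ hdiv => integral_inner_test_smul_gradient_eq_zero hψ hdiv hg.continuous (hθs i)) hv
    have hint : Integrable (fun p : ℝ × UnitAddTorus d =>
        ⟪(v : ℝ × UnitAddTorus d → EuclideanSpace ℝ d) p, g p.1 • FunctionSpaces.Torus.gradient (θ i) p.2⟫_ℝ) (((volume : Measure ℝ).restrict (Ioo 0 T)).prod (volume : Measure (UnitAddTorus d))) := by
      refine Integrable.mono' ((((hvL2.integrable_norm_pow two_ne_zero)).add (hG.integrable_norm_pow two_ne_zero)).div_const 2)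
        (hvm.inner hG.1) (ae_of_all _ fun p => ?_)
      show ‖⟪(v : ℝ × UnitAddTorus d → EuclideanSpace ℝ d) p, g p.1 • FunctionSpaces.Torus.gradient (θ i) p.2⟫_ℝ‖ ≤
        (‖(v : ℝ × UnitAddTorus d → EuclideanSpace ℝ d) p‖ ^ 2 + ‖g p.1 • FunctionSpaces.Torus.gradient (θ i) p.2‖ ^ 2) / 2
      rw [Real.norm_eq_abs]
      refine (abs_real_inner_le_norm _ _).trans ?_
      nlinarith [sq_nonneg (‖(v : ℝ × UnitAddTorus d → EuclideanSpace ℝ d) p‖ - ‖g p.1 • FunctionSpaces.Torus.gradient (θ i) p.2‖)]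
    rw [integral_prod _ hint] at h0
    have e1 : ∫ t in Ioo 0 T, ∫ x, ⟪(v : ℝ × UnitAddTorus d → EuclideanSpace ℝ d) (t, x),
        g (t, x).1 • FunctionSpaces.Torus.gradient (θ i) (t, x).2⟫_ℝ = ∫ t in Ioo 0 T, g t • F i t := by
      refine integral_congr_ae (ae_of_all _ fun t => ?_)
      simp only [hF, real_inner_smul_right, integral_const_mul, smul_eq_mul]
    rw [e1] at h0
    rw [← h0]
    symm
    refine setIntegral_eq_integral_of_forall_compl_eq_zero fun t ht => ?_
    rw [image_eq_zero_of_notMem_tsupport (fun h => ht (hgT h)), zero_smul]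
  -- du Bois-Reymond: `F_i = 0` a.e. on `(0,T)`, for every `i`
  have hae : ∀ i, ∀ᵐ t ∂(volume.restrict (Ioo 0 T)), F i t = 0 := by
    intro i
    have h := (isOpen_Ioo (a := (0:ℝ)) (b := T)).ae_eq_zero_of_integral_contDiff_smul_eq_zero
      (hFint i).locallyIntegrableOn (hgF i)
    rw [ae_restrict_iff' measurableSet_Ioo]
    exact h
  rw [← ae_all_iff] at hae
  filter_upwards [hae, ae_memLp_two_slice_prod hvL2] with t ht hL2
  refine ⟨hL2, isWeaklyDivFree_of_sum_mul_mFourierCoeff_eq_zero hL2 fun k => ?_⟩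
  refine sum_mul_mFourierCoeff_eq_zero_of_forall_pairing hL2 k fun z hz => ?_
  rcases hz with rfl | rfl
  · simpa [hF, hθ, hzOf] using ht (k, true)
  · simpa [hF, hθ, hzOf] using ht (k, false)

end Torus

end Literature.Analysis.FluidPDE

end
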